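/-
Copyright (c) 2026 the pub-hodgecm-mathlib formalisation cell (harness21).  Prover seat hodgecm-mathlib-K2E3-p08 (g0),
Track B «K2-LIT» ∕ h413, unit U4 «Keys» of the line `K2_E3_EllipticInputs`: second rung of socket #6 `sig_K2E3IrregularReducibleCaseThree`
(dealer K2E3-plan (g1) DEALS BATCH #2, 2026-09-03) — `dim End_G(i_G(χ)) = 2 ⟺` THE JACQUET MODULE `r_B i_G(χ)` IS `χ`-ISOTYPIC (⟺ SEMISIMPLE, AT `wχ = χ`).
-/
import Summits.HodgeConjecture.HodgeConjecture.Theorems.K2E3PSEndDimLeTwo                   -- ★ p855139 (this seat): `exists_linearMap_toLinearMap`, `finrank_end_cmPrincipalSeries_le_two`; brings ★ N1, ★ Frobenius, ★ p854977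
import Mathlib.RepresentationTheory.Semisimple                                             -- `Representation.IsSemisimpleRepresentation` (= `ComplementedLattice (Subrepresentation ρ)`)
import Mathlib.LinearAlgebra.Basis.VectorSpace                                             -- `Submodule.complementedLattice` (vector spaces)
import Mathlib.LinearAlgebra.Dual.Lemmas                                                   -- `Module.forall_dual_apply_eq_zero_iff`
import Mathlib.LinearAlgebra.FiniteDimensional.Lemmas                                      -- `LinearMap.injective_iff_surjective_of_finrank_eq_finrank`
import HarnessLib

/-!
# K2_E3 road (h413 = stmt-HodgeConjecture-24833), unit U4 «Keys», second rung of #6: `dim_ℂ End_G(i_G(χ)) = 2` if and only if `T` acts on the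
# Jacquet module `r_B i_G(χ)` through `χ` — at `wχ = χ`, if and only if `r_B i_G(χ)` is SEMISIMPLE (`≅ χ ⊕ χ`, the split self-extension)

Cell `pub/hodgecm-mathlib` (D-0151), Track B (21-frontier RULING «PUSH BOTH» 2026-09-03, director req624, chair K2-lead ORDER #1 ∕ #2, naming rule
s1813), dealer K2E3-plan (g1) DEALS BATCH #2 (K2/STATUS.md 2026-09-03T22:15:20Z): «p08 → (a) GO `Theorems/K2E3PSEndDimTwoIffJacquetSemisimple.lean`
(`finrank End = 2 ⟺ r_B i_G(χ) semisimple`, Frobenius both ways)».  Socket #6 `U4Keys.sig_K2E3IrregularReducibleCaseThree` (SIGS TABLE row #6, XL) is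
Keys' theorem at `wχ = χ`: «The unitary principal series `Ind_P^G λ` is reducible if and only if `λ ≠ 1`, `wλ = λ`, and `λ|F^× = 1`» [Keys1984, §7 Thm. (1)],
through Harish-Chandra's commuting-algebra theorem [Keys1984, §3 Thm. 1] and Silberger's «The dimension of the commuting algebra of `Ind_P^G λ` is equal
to `|W'_λ|`» [Keys1984, §3 Thm. 2].  The first rung ★ p855139 gave `dim End_G(i_G(χ)) ≤ 2` (every `χ`) and `= 1` off the `w`-fixed locus; THIS FILE
pins down WHEN the dimension is `2`: exactly when the two-dimensional Jacquet module `r_B i_G(χ)` (★ N1: a `T`-stable line `ℓ` on which `T` acts by `wχ`,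
quotient `χ`) is `χ`-ISOTYPIC — `T` acts on all of it through `χ` — which at `wχ = χ` says that the self-extension `0 → χ → r_B i_G(χ) → χ → 0` SPLITS,
i.e. `r_B i_G(χ)` is semisimple (Mathlib `Representation.IsSemisimpleRepresentation`: every `T`-stable subspace has a `T`-stable complement).  Off the
`w`-fixed locus both sides fail (dimension `1`, ★ p855139; `T` acts by `wχ ≠ χ` on `ℓ ≠ 0`), so the scalar-action form of the equivalence holds for
EVERY continuous `χ`.

THE MATHEMATICS (strategy: Frobenius reciprocity both ways + duality on a finite-dimensional space; no intertwining operator is constructed).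
`G = U(Φ₃)(L⁺_v)`, `v` NON-SPLIT, `χ = (χ₁, χ₂)` CONTINUOUS, `I = i_G(χ)` = ★ `cmPrincipalSeries L 3 v (cmTorusCharPair L v χ₁ χ₂)`, `X = r_B I`
(★ `Representation.normalizedJacquet`, `dim X = 2` ★ N1), `ℂ_χ` = `(trivial).twist χ`.
* §1 (linear algebra, any group `M`, any finite-dimensional `M`-representation `r` on `X`, any character `χ`):
  (a) `finrank_intertwiningMap_character_eq_iff` — `dim Hom_M(X, ℂ_χ) = dim X ⟺ ∀ m x, r(m)x = χ(m)x`: `Hom_M(X, ℂ_χ) ↪ X^∨` (★ p855139 §1) is onto iff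
  EVERY functional is `χ`-equivariant iff (duality, Mathlib `Module.forall_dual_apply_eq_zero_iff`) `r(m) − χ(m) = 0` for all `m`; and its transport
  `finrank_eq_iff_forall_eq_smul_of_linearEquiv` along any `E ≃ₗ Hom_M(X, ℂ_χ)` (the shape Frobenius reciprocity is consumed in — ONE `exact` at the CM datum);
  (b) `isSemisimpleRepresentation_of_forall_eq_smul` — if `M` acts through `χ` then every subspace is `M`-stable, `Subrepresentation r ≃o Submodule ℂ X`,
  and the latter is complemented (Mathlib `Submodule.complementedLattice`);
  (c) `forall_eq_smul_of_isSemisimpleRepresentation` — conversely, if `r` is semisimple and has an `M`-stable subspace `ℓ` with `M` acting by `χ` on `ℓ`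
  AND on `X ⁄ ℓ` (`r(m)x − χ(m)x ∈ ℓ`), then an `M`-stable complement `ℓ′` of `ℓ` has `r(m)z − χ(m)z ∈ ℓ ∩ ℓ′ = 0` for `z ∈ ℓ′`, so `M` acts by `χ` on `ℓ + ℓ′ = X`.
* §2 (the CM datum): Frobenius reciprocity ★ `F0P2nFrobeniusCmPrincipalSeries.frobenius_cmPrincipalSeries` [BernsteinZelevinsky1977, Prop. 1.9 (b)]
  `End_G(I) ≃ₗ[ℂ] Hom_T(X, ℂ_χ)` + ★ N1 (`dim X = 2`, through ★ `…_iff`) + §1 (a) give **`finrank_end_eq_two_iff_jacquet_eq_smul`**: for EVERY continuous `χ`,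
  `dim End_G(i_G(χ)) = 2 ⟺ ∀ m x, r_B(m)x = χ(m)x`.  At `wχ = χ` (★ `cmTorusCharPair χ₁ χ₂ = cmTorusCharPair (conjInvChar χ₁) χ₂`; then ★ N1's line `ℓ` is a
  `χ`-line, `cmWeylTorusCharPair_eq` being `rfl`) §1 (b)(c) give **`jacquet_eq_smul_iff_isSemisimpleRepresentation_of_weylFixed`** and the dealt sentence
  **`finrank_end_eq_two_iff_isSemisimpleRepresentation_jacquet_of_weylFixed`**: `dim End_G(i_G(χ)) = 2 ⟺ r_B i_G(χ)` is semisimple; with ★ p855139's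
  `≤ 2` and `id ≠ 0` the complementary reading **`finrank_end_eq_one_iff_not_isSemisimpleRepresentation_jacquet_of_weylFixed`**: `dim = 1 ⟺` the
  self-extension `r_B i_G(χ)` of `χ` by `χ` does NOT split.  (Which alternative holds — print: split iff `λ|F^× = 1`, `λ ≠ 1` — is socket #6's analytic
  content, the normalised operator `𝒜(w, λ)` [Keys1984, §3 Thm. 3, §7]; NOT claimed here.)

WHAT IS NOT HERE.  Socket #6 itself; the `R`-group; any statement at a split place or for discontinuous `χ`.

HONEST LABEL: HC_CM is proved only modulo the 7 printed citations (2 remaining named inputs: hLiu418 = stmt-HodgeConjecture-24832, h413 =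
stmt-HodgeConjecture-24833) until rung 0 closes; this file is a `--supports stmt-HodgeConjecture-24833` helper (second rung of socket #6 of the K2_E3 road)
and retires nothing by itself.  Theorems only: no definition, no instance, no notation, no named fact, no `sorry`; ★-only imports (no `Cruxes/…/Lines`).

## References
* [Keys1984] D. Keys, *Principal series representations of special unitary groups over local fields*, Compositio Math. 51 (1984) 115–130, §3 Thms. 1–3
  (Harish-Chandra's commuting-algebra theorem, Silberger's dimension formula, `ℂ[R]`), §7 Theorem (1) p. 126.
* [Casselman1995] W. Casselman, *Introduction to the theory of admissible representations of `p`-adic reductive groups* (draft 1 May 1995), §6.4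
  Prop. 6.4.1 pp. 61–62, §7.1 L. 7.1.1 (a) p. 67.
* [BernsteinZelevinsky1977] I. N. Bernstein, A. V. Zelevinsky, *Induced representations of reductive `p`-adic groups. I*, Ann. Sci. ÉNS (4) 10 (1977),
  Prop. 1.9 (b), §2.12 Geometrical Lemma, Cor. 2.13 (c), Thm. 2.9.
* [Rogawski1990] J. D. Rogawski, *Automorphic Representations of Unitary Groups in Three Variables*, Ann. of Math. Stud. 123 (1990), §12.1 p. 171, §12.2 (3) pp. 173–174.
-/

set_option autoImplicit false
-- the mandated namespace repeats the single-problem summit's segment (`HodgeConjecture.HodgeConjecture`)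
set_option linter.dupNamespace false

noncomputable section

open NumberField IsDedekindDomain MeasureTheory
open scoped Matrix

open Literature.NumberTheory Literature.NumberTheory.Automorphic Literature.NumberTheory.Automorphic.UnitaryGroup

namespace Summit.HodgeConjecture.HodgeConjecture.Cruxes.H413.K2E3PSEndDimTwoIffJacquetSemisimple

/-! ## §1 Linear algebra: when is `Hom_M(X, ℂ_χ)` all of `X^∨`, and `χ`-isotypic ⟺ semisimple with a `χ`-line and `χ`-quotient -/

section LinearAlgebra

variable {M : Type*} [Group M] {X : Type*} [AddCommGroup X] [Module ℂ X]

/-- **`dim Hom_M(X, ℂ_χ) = dim X ⟺ M acts on X through χ`** (`X` finite-dimensional).  `Hom_M(X, ℂ_χ)` embeds in `X^∨` by `ψ ↦ ψ.toLinearMap`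
(★ `K2E3PSEndDimLeTwo.exists_linearMap_toLinearMap`); equality of dimensions makes the embedding onto, i.e. EVERY linear functional is `χ`-equivariant,
i.e. every functional kills `r(m)x − χ(m)x`, i.e. (duality) `r(m)x = χ(m)x`; and conversely. [folklore] [cite: Casselman1995, §6.4 Prop. 6.4.1 p. 62] -/
theorem finrank_intertwiningMap_character_eq_iff (r : Representation ℂ M X) [FiniteDimensional ℂ X] (χ : M →* ℂˣ) :
    Module.finrank ℂ (r.IntertwiningMap ((Representation.trivial ℂ M ℂ).twist χ)) = Module.finrank ℂ X ↔
    ∀ (m : M) (x : X), r m x = ((χ m : ℂˣ) : ℂ) • x := by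
  obtain ⟨ι, hι, hιapp⟩ := K2E3PSEndDimLeTwo.exists_linearMap_toLinearMap r ((Representation.trivial ℂ M ℂ).twist χ)
  haveI : FiniteDimensional ℂ (r.IntertwiningMap ((Representation.trivial ℂ M ℂ).twist χ)) := Module.Finite.of_injective ι hι
  have hdual : Module.finrank ℂ (X →ₗ[ℂ] ℂ) = Module.finrank ℂ X := Module.finrank_linearMap_self ℂ ℂ X
  constructor
  · intro h m x
    have hsurj : Function.Surjective ι :=
      (LinearMap.injective_iff_surjective_of_finrank_eq_finrank (h.trans hdual.symm)).1 hι
    rw [← sub_eq_zero, ← Module.forall_dual_apply_eq_zero_iff ℂ]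
    intro φ
    obtain ⟨ψ, rfl⟩ := hsurj φ
    rw [hιapp, map_sub, map_smul, Representation.IntertwiningMap.toLinearMap_apply, Representation.IntertwiningMap.toLinearMap_apply,
      Representation.IntertwiningMap.isIntertwining, Representation.twist_apply, Representation.trivial_apply, sub_self]
  · intro h
    have hsurj : Function.Surjective ι := by
      intro φ
      refine ⟨⟨φ, fun m => LinearMap.ext fun x => ?_⟩, by rw [hιapp]⟩
      simp only [LinearMap.coe_comp, Function.comp_apply, h m x, map_smul, Representation.twist_apply, Representation.trivial_apply]
    exact (LinearEquiv.ofBijective ι ⟨hι, hsurj⟩).finrank_eq.trans hdual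

/-- **Transport of §1 (a) along a linear equivalence** `E ≃ₗ Hom_M(X, ℂ_χ)` (the shape in which Frobenius reciprocity is consumed: `E = End_G(i_G(χ))`,
`dim X = n`): `dim E = n ⟺ M acts on X through χ`.  Stated abstractly so that the CM instance below is ONE `exact` (no rewriting inside the
≈ 10⁷-node carrier types of the principal series). [folklore] [cite: BernsteinZelevinsky1977, Prop. 1.9 (b)] -/
theorem finrank_eq_iff_forall_eq_smul_of_linearEquiv {E : Type*} [AddCommGroup E] [Module ℂ E]
    (r : Representation ℂ M X) [FiniteDimensional ℂ X] (χ : M →* ℂˣ)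
    (e : E ≃ₗ[ℂ] r.IntertwiningMap ((Representation.trivial ℂ M ℂ).twist χ)) {n : ℕ} (hn : Module.finrank ℂ X = n) :
    Module.finrank ℂ E = n ↔ ∀ (m : M) (x : X), r m x = ((χ m : ℂˣ) : ℂ) • x := by
  rw [e.finrank_eq, ← hn]
  exact finrank_intertwiningMap_character_eq_iff r χ

/-- **If `M` acts on `X` through a character `χ`, the `M`-representation `X` is semisimple**: every subspace is `M`-stable, so the lattice of
subrepresentations IS the (complemented) lattice of subspaces. [folklore] -/
theorem isSemisimpleRepresentation_of_forall_eq_smul (r : Representation ℂ M X) (χ : M →* ℂˣ)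
    (h : ∀ (m : M) (x : X), r m x = ((χ m : ℂˣ) : ℂ) • x) : r.IsSemisimpleRepresentation := by
  let e : Submodule ℂ X ≃o Subrepresentation r :=
    { toFun := fun p => ⟨p, fun m x hx => by rw [h m x]; exact p.smul_mem _ hx⟩
      invFun := fun q => q.toSubmodule
      left_inv := fun _ => rfl
      right_inv := fun _ => rfl
      map_rel_iff' := Iff.rfl }
  exact e.complementedLattice

/-- **Conversely: a SEMISIMPLE `X` with an `M`-stable subspace `ℓ` on which, and modulo which, `M` acts through `χ` is `χ`-isotypic.**  An `M`-stable
complement `ℓ′` of `ℓ` exists; for `z ∈ ℓ′`, `r(m)z − χ(m)z` lies in `ℓ′` (stability) and in `ℓ` (the quotient action), hence is `0`; and `X = ℓ + ℓ′`.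
[folklore] [cite: Keys1984, §3 Thm. 1] -/
theorem forall_eq_smul_of_isSemisimpleRepresentation (r : Representation ℂ M X) (χ : M →* ℂˣ) (hss : r.IsSemisimpleRepresentation)
    (ℓ : Submodule ℂ X) (hℓ : ∀ (m : M), ∀ x ∈ ℓ, r m x = ((χ m : ℂˣ) : ℂ) • x) (hq : ∀ (m : M) (x : X), r m x - ((χ m : ℂˣ) : ℂ) • x ∈ ℓ) :
    ∀ (m : M) (x : X), r m x = ((χ m : ℂˣ) : ℂ) • x := by
  haveI := hss
  -- `ℓ` as a subrepresentation, and an `M`-stable complement `ℓ′`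
  let L : Subrepresentation r := ⟨ℓ, fun m x hx => by rw [hℓ m x hx]; exact ℓ.smul_mem _ hx⟩
  obtain ⟨L', hc⟩ := exists_isCompl L
  have hinf : ℓ ⊓ L'.toSubmodule = ⊥ := congrArg Subrepresentation.toSubmodule hc.inf_eq_bot
  have hsup : ℓ ⊔ L'.toSubmodule = ⊤ := congrArg Subrepresentation.toSubmodule hc.sup_eq_top
  -- on `ℓ′`, `M` acts by `χ`
  have hℓ' : ∀ (m : M), ∀ z ∈ L'.toSubmodule, r m z = ((χ m : ℂˣ) : ℂ) • z := by
    intro m z hz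
    have h1 : r m z - ((χ m : ℂˣ) : ℂ) • z ∈ L'.toSubmodule :=
      L'.toSubmodule.sub_mem (L'.apply_mem_toSubmodule m hz) (L'.toSubmodule.smul_mem _ hz)
    have h0 : r m z - ((χ m : ℂˣ) : ℂ) • z ∈ ℓ ⊓ L'.toSubmodule := Submodule.mem_inf.2 ⟨hq m z, h1⟩
    rw [hinf, Submodule.mem_bot] at h0
    exact sub_eq_zero.1 h0
  intro m x
  have hx : x ∈ ℓ ⊔ L'.toSubmodule := by rw [hsup]; exact Submodule.mem_top
  obtain ⟨y, hy, z, hz, rfl⟩ := Submodule.mem_sup.1 hx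
  rw [map_add, smul_add, hℓ m y hy, hℓ' m z hz]

end LinearAlgebra

/-! ## §2 The principal series of `U(Φ₃)(L⁺_v)` at a non-split place -/

section CM

variable (L : Type) [Field L] [NumberField L] [IsCMField L] (v : HeightOneSpectrum (𝓞 ↥(maximalRealSubfield L)))

set_option synthInstance.maxHeartbeats 400000 in
set_option maxHeartbeats 8000000 in
/-- **`dim_ℂ End_G(i_G(χ)) = 2 ⟺ T acts on the Jacquet module r_B i_G(χ) through χ`** (`G = U(Φ₃)(L⁺_v)`, `v` NON-SPLIT, `χ = (χ₁, χ₂)` CONTINUOUS —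
regular or not): Frobenius reciprocity ★ `frobenius_cmPrincipalSeries` (`End_G(i_G(χ)) ≃ₗ Hom_T(r_B i_G(χ), ℂ_χ)`), ★ N1 (`dim r_B i_G(χ) = 2`) and §1 (a).
Off the `w`-fixed locus both sides are false (dimension `1`, ★ `K2E3PSEndDimLeTwo.finrank_end_cmPrincipalSeries_eq_one_of_regular`; the `wχ`-line); on it,
the right-hand side says that the self-extension `r_B i_G(χ)` of `χ` by `χ` splits.
[cite: Keys1984, §3 Thms. 1–2] [cite: BernsteinZelevinsky1977, Prop. 1.9 (b); Cor. 2.13 (c)] [cite: Casselman1995, §6.4 Prop. 6.4.1 p. 62; §7.1 L. 7.1.1 (a) p. 67]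
[cite: Rogawski1990, §12.2 (3) p. 173] -/
theorem finrank_end_eq_two_iff_jacquet_eq_smul
    (hns : ∀ w : PlacesOver L v, IsCMField.complexConj L • w.1 = w.1)
    (χ₁ : (LocalRing L v)ˣ →* ℂˣ) (χ₂ : ↥(normOneUnits (conjLocal L (IsCMField.complexConj L) v)) →* ℂˣ)
    (h₁ : Continuous fun x => ((χ₁ x : ℂˣ) : ℂ)) (h₂ : Continuous fun x => ((χ₂ x : ℂˣ) : ℂ)) :
    Module.finrank ℂ ((cmPrincipalSeries L 3 v (cmTorusCharPair L v χ₁ χ₂)).IntertwiningMap (cmPrincipalSeries L 3 v (cmTorusCharPair L v χ₁ χ₂))) = 2 ↔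
    (haveI := locallyCompactSpace_cmBorelU L 3 v
     ∀ (m : ↥(cmBorelTriple L 3 v).M) (x : ((cmBorelTriple L 3 v).restrict (cmPrincipalSeries L 3 v (cmTorusCharPair L v χ₁ χ₂))).Coinvariants),
       (cmPrincipalSeries L 3 v (cmTorusCharPair L v χ₁ χ₂)).normalizedJacquet (cmBorelTriple L 3 v) m x =
         ((cmTorusCharPair L v χ₁ χ₂ m : ℂˣ) : ℂ) • x) := by
  -- (no tactic-level `LocallyCompactSpace` instance: every Jacquet-side term below is READ OFF ★ statements, which inline the same constant
  -- instance as this statement — keeps unification syntactic on the ≈ 10⁷-node carrier types)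
  -- ★ N1 (conjuncts 1–2): `r_B i_G(χ)` finite-dimensional, `dim = 2`
  have hN1 := (UnitaryGroup.U3PrincipalSeriesJacquetFiltration_iff L).1
    (F0P3U3PrincipalSeriesJacquetFiltrationHolds.U3PrincipalSeriesJacquetFiltration_holds L) v hns χ₁ χ₂ h₁ h₂
  haveI := hN1.1
  -- ★ Frobenius reciprocity for the smooth `π = i_G(χ)` into `i_G(χ)`, then §1 (a) transported along it
  refine (F0P2nFrobeniusCmPrincipalSeries.frobenius_cmPrincipalSeries L v (cmTorusCharPair L v χ₁ χ₂)
    (cmPrincipalSeries L 3 v (cmTorusCharPair L v χ₁ χ₂)) (F0P2pCmPrincipalSeriesInterface.isSmooth_cmPrincipalSeries L v _)).elim fun e => ?_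
  exact finrank_eq_iff_forall_eq_smul_of_linearEquiv _ _ e hN1.2.1

set_option synthInstance.maxHeartbeats 400000 in
set_option maxHeartbeats 8000000 in
/-- **At `wχ = χ`: `T` acts on `r_B i_G(χ)` through `χ` ⟺ `r_B i_G(χ)` is SEMISIMPLE** (Mathlib `Representation.IsSemisimpleRepresentation`).  On the `w`-fixed
locus ★ N1's `T`-stable line `ℓ` carries `wχ = χ` and the quotient carries `χ`, so `r_B i_G(χ)` is a self-extension of `χ` by `χ`; it is `χ`-isotypic iff it
splits (§1 (b), (c)).  [cite: Keys1984, §3 Thm. 1; §7 Theorem (1) p. 126] [cite: Casselman1995, §7.1 L. 7.1.1 (a) p. 67] [cite: Rogawski1990, §12.2 (3) p. 173] -/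
theorem jacquet_eq_smul_iff_isSemisimpleRepresentation_of_weylFixed
    (hns : ∀ w : PlacesOver L v, IsCMField.complexConj L • w.1 = w.1)
    (χ₁ : (LocalRing L v)ˣ →* ℂˣ) (χ₂ : ↥(normOneUnits (conjLocal L (IsCMField.complexConj L) v)) →* ℂˣ)
    (h₁ : Continuous fun x => ((χ₁ x : ℂˣ) : ℂ)) (h₂ : Continuous fun x => ((χ₂ x : ℂˣ) : ℂ))
    (heq : cmTorusCharPair L v χ₁ χ₂ = cmTorusCharPair L v (conjInvChar (conjLocal L (IsCMField.complexConj L) v) χ₁) χ₂) :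
    haveI := locallyCompactSpace_cmBorelU L 3 v
    (∀ (m : ↥(cmBorelTriple L 3 v).M) (x : ((cmBorelTriple L 3 v).restrict (cmPrincipalSeries L 3 v (cmTorusCharPair L v χ₁ χ₂))).Coinvariants),
       (cmPrincipalSeries L 3 v (cmTorusCharPair L v χ₁ χ₂)).normalizedJacquet (cmBorelTriple L 3 v) m x =
         ((cmTorusCharPair L v χ₁ χ₂ m : ℂˣ) : ℂ) • x) ↔
    ((cmPrincipalSeries L 3 v (cmTorusCharPair L v χ₁ χ₂)).normalizedJacquet (cmBorelTriple L 3 v)).IsSemisimpleRepresentation := by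
  constructor
  · intro h
    exact isSemisimpleRepresentation_of_forall_eq_smul _ (cmTorusCharPair L v χ₁ χ₂) h
  · intro hss
    -- ★ N1 (conjunct 3): the `T`-stable line `ℓ` with `wχ` on it and `χ` modulo it (projections + `Exists.elim`, no `cases` on the big goal)
    have hN1 := (UnitaryGroup.U3PrincipalSeriesJacquetFiltration_iff L).1
      (F0P3U3PrincipalSeriesJacquetFiltrationHolds.U3PrincipalSeriesJacquetFiltration_holds L) v hns χ₁ χ₂ h₁ h₂
    refine hN1.2.2.elim fun ℓ hℓ => ?_
    -- on the `w`-fixed locus the line character IS `χ` (`cmWeylTorusCharPair_eq` is `rfl`); rewritten POINTWISE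
    have hww : cmWeylTorusCharPair L v χ₁ χ₂ = cmTorusCharPair L v χ₁ χ₂ := by
      rw [cmWeylTorusCharPair_eq, ← heq]
    have hline := fun m x hx => (hℓ.2.1 m x hx).trans (by rw [hww])
    exact forall_eq_smul_of_isSemisimpleRepresentation _ (cmTorusCharPair L v χ₁ χ₂) hss ℓ hline hℓ.2.2

set_option synthInstance.maxHeartbeats 400000 in
set_option maxHeartbeats 8000000 in
/-- **THE DEALT SENTENCE: at `wχ = χ`, `dim_ℂ End_G(i_G(χ)) = 2 ⟺ r_B i_G(χ)` is semisimple** (`G = U(Φ₃)(L⁺_v)`, `v` non-split, `χ = (χ₁, χ₂)` continuous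
with `(χ₁, χ₂) = w(χ₁, χ₂) = (χ̄₁⁻¹, χ₂)`).  Frobenius both ways (`finrank_end_eq_two_iff_jacquet_eq_smul`) + the semisimplicity reading
(`jacquet_eq_smul_iff_isSemisimpleRepresentation_of_weylFixed`).  This is the dichotomy behind Keys' case (3): the commuting algebra `span{id, 𝒜(w,λ)}` is
two-dimensional exactly when the Jacquet self-extension splits.  [cite: Keys1984, §3 Thms. 1–3; §7 Theorem (1) p. 126]
[cite: BernsteinZelevinsky1977, Prop. 1.9 (b); Cor. 2.13 (c); Thm. 2.9] [cite: Casselman1995, §6.4 Prop. 6.4.1 p. 62; §7.1 L. 7.1.1 (a) p. 67] [cite: Rogawski1990, §12.2 (3) pp. 173–174] -/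
theorem finrank_end_eq_two_iff_isSemisimpleRepresentation_jacquet_of_weylFixed
    (hns : ∀ w : PlacesOver L v, IsCMField.complexConj L • w.1 = w.1)
    (χ₁ : (LocalRing L v)ˣ →* ℂˣ) (χ₂ : ↥(normOneUnits (conjLocal L (IsCMField.complexConj L) v)) →* ℂˣ)
    (h₁ : Continuous fun x => ((χ₁ x : ℂˣ) : ℂ)) (h₂ : Continuous fun x => ((χ₂ x : ℂˣ) : ℂ))
    (heq : cmTorusCharPair L v χ₁ χ₂ = cmTorusCharPair L v (conjInvChar (conjLocal L (IsCMField.complexConj L) v) χ₁) χ₂) :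
    Module.finrank ℂ ((cmPrincipalSeries L 3 v (cmTorusCharPair L v χ₁ χ₂)).IntertwiningMap (cmPrincipalSeries L 3 v (cmTorusCharPair L v χ₁ χ₂))) = 2 ↔
    (haveI := locallyCompactSpace_cmBorelU L 3 v
     ((cmPrincipalSeries L 3 v (cmTorusCharPair L v χ₁ χ₂)).normalizedJacquet (cmBorelTriple L 3 v)).IsSemisimpleRepresentation) :=
  (finrank_end_eq_two_iff_jacquet_eq_smul L v hns χ₁ χ₂ h₁ h₂).trans
    (jacquet_eq_smul_iff_isSemisimpleRepresentation_of_weylFixed L v hns χ₁ χ₂ h₁ h₂ heq)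

set_option synthInstance.maxHeartbeats 400000 in
set_option maxHeartbeats 8000000 in
/-- **Complementary reading at `wχ = χ`: `dim_ℂ End_G(i_G(χ)) = 1 ⟺` the Jacquet self-extension does NOT split** (`r_B i_G(χ)` not semisimple).  From the
dealt sentence and ★ p855139: `End_G(i_G(χ))` is finite-dimensional of dimension `≤ 2` and `≠ 0` (`id ≠ 0`, ★ `id_ne_zero_of_nontrivial_coinvariants`), so the
dimension is `1` or `2`.  [cite: Keys1984, §3 Thms. 1–2; §7 Theorem (1) p. 126] [cite: Casselman1995, §7.1 L. 7.1.1 (a) p. 67] -/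
theorem finrank_end_eq_one_iff_not_isSemisimpleRepresentation_jacquet_of_weylFixed
    (hns : ∀ w : PlacesOver L v, IsCMField.complexConj L • w.1 = w.1)
    (χ₁ : (LocalRing L v)ˣ →* ℂˣ) (χ₂ : ↥(normOneUnits (conjLocal L (IsCMField.complexConj L) v)) →* ℂˣ)
    (h₁ : Continuous fun x => ((χ₁ x : ℂˣ) : ℂ)) (h₂ : Continuous fun x => ((χ₂ x : ℂˣ) : ℂ))
    (heq : cmTorusCharPair L v χ₁ χ₂ = cmTorusCharPair L v (conjInvChar (conjLocal L (IsCMField.complexConj L) v) χ₁) χ₂) :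
    Module.finrank ℂ ((cmPrincipalSeries L 3 v (cmTorusCharPair L v χ₁ χ₂)).IntertwiningMap (cmPrincipalSeries L 3 v (cmTorusCharPair L v χ₁ χ₂))) = 1 ↔
    ¬ (haveI := locallyCompactSpace_cmBorelU L 3 v
       ((cmPrincipalSeries L 3 v (cmTorusCharPair L v χ₁ χ₂)).normalizedJacquet (cmBorelTriple L 3 v)).IsSemisimpleRepresentation) := by
  rw [← finrank_end_eq_two_iff_isSemisimpleRepresentation_jacquet_of_weylFixed L v hns χ₁ χ₂ h₁ h₂ heq]
  -- `1 ≤ dim ≤ 2` (projections, no `cases` on the big goal)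
  have hle2 := K2E3PSEndDimLeTwo.finrank_end_cmPrincipalSeries_le_two L v hns χ₁ χ₂ h₁ h₂
  haveI := hle2.1
  have hle := hle2.2
  have hN1 := (UnitaryGroup.U3PrincipalSeriesJacquetFiltration_iff L).1
    (F0P3U3PrincipalSeriesJacquetFiltrationHolds.U3PrincipalSeriesJacquetFiltration_holds L) v hns χ₁ χ₂ h₁ h₂
  have hX2 := hN1.2.1
  have hid : Representation.IntertwiningMap.id (cmPrincipalSeries L 3 v (cmTorusCharPair L v χ₁ χ₂)) ≠ 0 :=
    F0P2pWeylConstituentsRankOne.id_ne_zero_of_nontrivial_coinvariants (cmBorelTriple L 3 v) _ (Module.nontrivial_of_finrank_eq_succ hX2)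
  have hpos : 0 < Module.finrank ℂ ((cmPrincipalSeries L 3 v (cmTorusCharPair L v χ₁ χ₂)).IntertwiningMap
      (cmPrincipalSeries L 3 v (cmTorusCharPair L v χ₁ χ₂))) :=
    Module.finrank_pos_iff_exists_ne_zero.2 ⟨_, hid⟩
  omega

end CM

end Summit.HodgeConjecture.HodgeConjecture.Cruxes.H413.K2E3PSEndDimTwoIffJacquetSemisimple

end
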